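import Literature.Geometry.Lorentzian.Sweep2
import Literature.Geometry.Lorentzian.BlackHoles
import Literature.Geometry.Lorentzian.ChartCalculus
import Literature.Geometry.Lorentzian.AdiabaticKerrSchildBackground

/-!
# The Teukolsky system on the horizon-penetrating Kerr–Schild charts `{r > r₀}`

`Sweep2.lean` (gr.S27) states the Teukolsky vocabulary — operator `Kerr.teukolskyOp`, admissible
fields `Kerr.IsAdmissibleTeukolskyField`, energies `Kerr.teukolskyEnergy` — on the OPEN exterior
`Kerr.exterior M a = Kerr.region a r₊` with Cauchy data compactly supported in the OPEN leaf
`{t* = 0, r > r₊}`. That class has zero Cauchy trace on the horizon sphere `{t* = 0, r = r₊}`, so no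
uniform-in-time bound stated over it transfers (by density) to horizon-CROSSING data: the closure of
`C_c^∞({r > r₊})` data in an `H^k`-type energy space, `k ≥ 1`, misses every datum with a non-zero
trace. Nonlinear stability schemes (Dafermos–Holzegel–Rodnianski–Taylor arXiv:2212.14093 §1.1, black
box (1.3); Klainerman–Szeftel; Hintz–Vasy) consume the linear theory on a region with a spacelike
inner boundary `{r = r₀}` strictly INSIDE the black hole (`r₋ < r₀ < r₊`), for the INHOMOGENEOUS
equation and for data whose support may straddle the event horizon; and the printed sub-extremal
Teukolsky theorem IS in that class (Shlapentokh-Rothman–Teixeira da Costa arXiv:2302.08916, Thm. A,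
p. 3: "general solutions … arising from sufficiently regular initial data on a Cauchy surface").

This file supplies the same four objects on the horizon-penetrating chart `Kerr.region a r₀`
(`Kerr.metric M a r₀` exists for every real `r₀`; canonical consumer choice `r₀ := M ∈ (r₋, r₊)`),
plus the inhomogeneous pair class, as routine glue over `Sweep2.lean`:

* `Kerr.cdalembertianOn`, `Kerr.teukolskyOpOn` — verbatim `Kerr.cdalembertian` / `Kerr.teukolskyOp`
  with `Kerr.metric M a r₀` in place of `Kerr.metric M a r₊` (definitionally the old ones at
  `r₀ = r₊`, `teukolskyOpOn_rPlus`);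
* `Kerr.IsAdmissibleTeukolskyFieldOn` — the horizon-REGULAR rescaled tensorised field
  `α̃ m_s ⊗ m_s` (`Kerr.tensorise a s (Kerr.rescale M a s α)`, DHR's `α̃^{[±2]}`) extends to a `C^∞`
  tensor field on the whole chart (across the axis AND across `H⁺ = {Δ = 0}`), its Cauchy data on
  `{t* = 0, r > r₀}` are compactly supported in that open leaf (the support may straddle `{r = r₊}`),
  and the Teukolsky equation holds off the axis and off `{Δ = 0}` (the coefficients of Teukolsky's
  (4.7) and of `Kerr.blRadialVector` carry `Δ⁻¹`, junk-zero on `{Δ = 0}` under `x/0 = 0`, so the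
  equation is never imposed there; continuity of the extension carries it across);
* `Kerr.IsAdmissibleTeukolskyPairOn` — the sourced version `𝔗^{[s]} α = F` with Cauchy data anchored
  at `{t* = 0}`;
* `Kerr.IsTeukolskyPairOnSlab`, `Kerr.TeukolskySlabLawOn` — the sourced class on a TIME SLAB
  `τ₀ ≤ t* ≤ τ₁` of the chart (fields `C^∞` on an open neighbourhood of the closed slab, NO support or
  decay condition anywhere: an infinite weighted energy only voids the law for that pair) and the
  black-box law in exactly the format of Dafermos–Holzegel–Rodnianski–Taylor arXiv:2212.14093, (1.3),
  at one parameter set `(M, a, r₀, k, w, R, Λ)`: local first-order energy through the top leaf + its time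
  integral over the slab `≤ Λ ×` (weighted `k`-th order energy through the bottom leaf + time-integrated
  weighted `k`-th order source energy) — the restartable form a nonlinear bootstrap consumes;
* `Kerr.teukolskyEnergyOn` — `sliceSobolevEnergy` of `α̃ m_s ⊗ m_s` through
  `{t* = τ} ∩ {r > r₀} ∩ {y ∈ A}` (definitionally `Kerr.teukolskyEnergy` at `r₀ = r₊`);
* `Kerr.IsAdmissibleTeukolskyField.fieldOn` — PROVED: the exterior class of `Sweep2` is contained
  in the new class at `r₀ = r₊` (the rescaling factor `Δ^s (r²+a²)^{-max(s,0)}` is smooth and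
  non-vanishing on the exterior, `Kerr.delta_pos_of_mem_exterior`, so `α̃ m_s ⊗ m_s = f • T` extends
  with the same compact data set), i.e. every law over the new class restricts to the old one.

Design choices. (i) Smoothness across `H⁺` is demanded of `α̃ = Δ^s (r²+a²)^{-max(s,0)} α`, not of
`α` (`α^{[+2]}` itself blows up like `Δ^{-2}` at `H⁺`; DHR Ann. PDE 5 (2019) §2.4); the values of
`α` ON `{Δ = 0}` and on the axis are unconstrained junk, invisible to the energies (measure zero in
every leaf) and to the equation (imposed off these sets). (ii) No statement (named fact) is made
here: the κ-explicit / sub-extremal laws over this class are open or crux-level elsewhere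
(`Summits/FinalStateConjecture`, route `PhaseMixingCapture`); this file is vocabulary only.
(iii) Not covered: the gauge-fixed linearised Einstein operator, `r^p`-weighted null-slab energies.
-/

noncomputable section

namespace Literature.Geometry.Lorentzian.Kerr

open scoped Manifold ContDiff ENNReal
open Set MeasureTheory

/-- The complex scalar wave operator `□_g α = □_g (re α) + i □_g (im α)` of the Kerr metric
`Kerr.metric M a r₀` on the horizon-penetrating chart `Kerr.region a r₀ = {r > max r₀ 0}`
(`PseudoRiemannianMetric.dalembertian`; verbatim `Kerr.cdalembertian` with `r₀` for `r₊`).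
Teukolsky, ApJ 185 (1973), (4.7) with `s = 0`; Dafermos–Holzegel–Rodnianski, Ann. PDE 5 (2019),
§2.3. [folklore] -/
def cdalembertianOn [Facts] (M a r₀ : ℝ) [(metric M a r₀).HasLeviCivita] (α : region a r₀ → ℂ)
    (x : region a r₀) : ℂ :=
  ((metric M a r₀).toPseudoRiemannianMetric.dalembertian (fun y ↦ (α y).re) x : ℂ) +
    Complex.I * ((metric M a r₀).toPseudoRiemannianMetric.dalembertian (fun y ↦ (α y).im) x : ℂ)

/-- The **Teukolsky operator of spin `s` on the horizon-penetrating chart `{r > r₀}`**, in the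
form "`ρ² □_g` + first order" — verbatim `Kerr.teukolskyOp` (Teukolsky's master operator (4.7) is
`−𝔗^{[s]}`; `ρ² = r² + a² cos² θ`, `Δ = r² − 2Mr + a²`, Boyer–Lindquist coordinate fields
`∂_{t*}`, `Kerr.blRadialVector`, `Kerr.blAxialVector`) with `Kerr.metric M a r₀` in place of the
exterior metric. **Junk** on the axis (`sin θ = 0`) AND on `{Δ = 0}` (the coefficients carry
`Δ⁻¹`, which is `0` there under `x/0 = 0`): the equation is only ever imposed off both sets
(`IsAdmissibleTeukolskyFieldOn`). Teukolsky, ApJ 185 (1973), (4.7); Dafermos–Holzegel–Rodnianski,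
Ann. PDE 5 (2019), §2.3. [folklore] -/
def teukolskyOpOn [Facts] (M a r₀ : ℝ) [(metric M a r₀).HasLeviCivita] (s : ℤ)
    (α : region a r₀ → ℂ) (x : region a r₀) : ℂ :=
  ((radius a x.1 ^ 2 + a ^ 2 * cosTheta a x.1 ^ 2 : ℝ) : ℂ) * cdalembertianOn M a r₀ α x +
    2 * (s : ℂ) * ((radius a x.1 - M : ℝ) : ℂ) * coordDeriv α x.1 (blRadialVector M a x.1) +
    2 * (s : ℂ) * (((a * (radius a x.1 - M) / delta M a (radius a x.1) : ℝ) : ℂ) +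
        Complex.I * ((cosTheta a x.1 / sinTheta a x.1 ^ 2 : ℝ) : ℂ)) *
      coordDeriv α x.1 (blAxialVector x.1) +
    2 * (s : ℂ) * (((M * (radius a x.1 ^ 2 - a ^ 2) / delta M a (radius a x.1) - radius a x.1
          : ℝ) : ℂ) - Complex.I * ((a * cosTheta a x.1 : ℝ) : ℂ)) *
      coordDeriv α x.1 (E4.basisVector 0) +
    ((s : ℂ) - (s : ℂ) ^ 2 * ((cosTheta a x.1 ^ 2 / sinTheta a x.1 ^ 2 : ℝ) : ℂ)) * α x

/-- On the exterior chart `r₀ = r₊` the operator is literally `Kerr.teukolskyOp`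
(`Kerr.exterior M a = Kerr.region a r₊` by definition). Teukolsky, ApJ 185 (1973), (4.7). [folklore] -/
theorem teukolskyOpOn_rPlus [Facts] (M a : ℝ) [(metric M a (rPlus M a)).HasLeviCivita] (s : ℤ)
    (α : exterior M a → ℂ) (x : exterior M a) :
    teukolskyOpOn M a (rPlus M a) s α x = teukolskyOp M a s α x :=
  rfl

/-- **Admissible spin-`s` Teukolsky fields on the horizon-penetrating chart `{r > r₀}`**
(`r₀ < r₊` intended, e.g. `r₀ = M ∈ (r₋, r₊)`; `s = ±2`): the horizon-regular rescaled tensorised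
field `α̃ m_s ⊗ m_s = Kerr.tensorise a s (Kerr.rescale M a s α)` (DHR's `α̃^{[±2]}`, Ann. PDE 5
(2019), §2.4) extends to a `C^∞` tensor field `T` on the WHOLE chart — across the axis and across
the event horizon `{Δ = 0}` —; the Cauchy data of `T` on the open leaf `{t* = 0, r > r₀}` are
compactly supported in it (outside a compact `K`, `T` and its differential vanish on the leaf; the
support may straddle the horizon sphere `{r = r₊}`, data supported away from the inner edge
`{r = r₀}` and from infinity); and `α` solves the Teukolsky equation `𝔗^{[s]} α = 0` off the axis
and off `{Δ = 0}` (everywhere as a spin-weighted identity for `α̃`, by continuity of `T`). This is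
the data class of the printed sub-extremal theorem (Shlapentokh-Rothman–Teixeira da Costa,
arXiv:2302.08916, Thm. A, p. 3: general solutions from regular data on a Cauchy surface crossing
`H⁺`) and of the black-box format consumed by nonlinear schemes (Dafermos–Holzegel–Rodnianski–Taylor,
arXiv:2212.14093, §1.1, (1.3): region `r ≥ r₀`, `r₀ < r_Killing`). At `r₀ = r₊` it contains
`Kerr.IsAdmissibleTeukolskyField` up to the (there automatic) guard `Δ ≠ 0`.
[cite: ShlapentokhrothmanCosta2023, Thm A p3] -/
def IsAdmissibleTeukolskyFieldOn [Facts] (M a r₀ : ℝ) [(metric M a r₀).HasLeviCivita] (s : ℤ)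
    (α : region a r₀ → ℂ) : Prop :=
  (∃ T : region a r₀ → Fin 4 → Fin 4 → ℂ,
      ContMDiff 𝓘(ℝ, E4) 𝓘(ℝ, Fin 4 → Fin 4 → ℂ) ∞ T ∧
        (∀ x : region a r₀, x.1 ∉ axis → delta M a (radius a x.1) ≠ 0 →
          T x = tensorise a s (rescale M a s α) x) ∧
        ∃ K : Set (region a r₀), IsCompact K ∧
          ∀ x : region a r₀, (x : E4) 0 = 0 → x ∉ K →
            T x = 0 ∧ mfderiv 𝓘(ℝ, E4) 𝓘(ℝ, Fin 4 → Fin 4 → ℂ) T x = 0) ∧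
    ∀ x : region a r₀, x.1 ∉ axis → delta M a (radius a x.1) ≠ 0 → teukolskyOpOn M a r₀ s α x = 0

/-- **Admissible SOURCED spin-`s` Teukolsky pairs `(α, F)` on `{r > r₀}`** — the inhomogeneous
black-box format `𝔗^{[s]} α = F` (Dafermos–Holzegel–Rodnianski–Taylor arXiv:2212.14093, (1.3);
Shlapentokh-Rothman–Teixeira da Costa arXiv:2302.08916, §8.1, "an inhomogeneous system from
hyperboloidal cutoffs"): `α̃ m_s ⊗ m_s` extends smoothly to the whole chart with compactly supported
Cauchy data on the open leaf `{t* = 0, r > r₀}` (as in `IsAdmissibleTeukolskyFieldOn`), the rescaled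
tensorised SOURCE `F̃ m_s ⊗ m_s` extends smoothly to the whole chart, and `𝔗^{[s]} α = F` off the
axis and off `{Δ = 0}`. No support or decay condition is put on `F` (an infinite source norm makes
any estimate over the pair trivially true, never false). [cite: DafermosHolzegelRodnianskiTaylor2022, §1.1 (1.3)] -/
def IsAdmissibleTeukolskyPairOn [Facts] (M a r₀ : ℝ) [(metric M a r₀).HasLeviCivita] (s : ℤ)
    (α F : region a r₀ → ℂ) : Prop :=
  (∃ T : region a r₀ → Fin 4 → Fin 4 → ℂ,
      ContMDiff 𝓘(ℝ, E4) 𝓘(ℝ, Fin 4 → Fin 4 → ℂ) ∞ T ∧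
        (∀ x : region a r₀, x.1 ∉ axis → delta M a (radius a x.1) ≠ 0 →
          T x = tensorise a s (rescale M a s α) x) ∧
        ∃ K : Set (region a r₀), IsCompact K ∧
          ∀ x : region a r₀, (x : E4) 0 = 0 → x ∉ K →
            T x = 0 ∧ mfderiv 𝓘(ℝ, E4) 𝓘(ℝ, Fin 4 → Fin 4 → ℂ) T x = 0) ∧
    (∃ S : region a r₀ → Fin 4 → Fin 4 → ℂ,
      ContMDiff 𝓘(ℝ, E4) 𝓘(ℝ, Fin 4 → Fin 4 → ℂ) ∞ S ∧
        ∀ x : region a r₀, x.1 ∉ axis → delta M a (radius a x.1) ≠ 0 →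
          S x = tensorise a s (rescale M a s F) x) ∧
    ∀ x : region a r₀, x.1 ∉ axis → delta M a (radius a x.1) ≠ 0 → teukolskyOpOn M a r₀ s α x = F x

/-- **Sourced spin-`s` Teukolsky pairs on a time slab `τ₀ ≤ t* ≤ τ₁` of the chart `{r > r₀}`**
(the class of the black box (1.3) of Dafermos–Holzegel–Rodnianski–Taylor arXiv:2212.14093, §1.1):
on the open neighbourhood `U_θ = {τ₀ − θ < t* < τ₁ + θ}` of the closed slab, the horizon-regular
rescaled tensorised field `α̃ m_s ⊗ m_s` and the rescaled tensorised source extend to `C^∞` tensor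
fields (across the axis AND across `{Δ = 0}`), and `𝔗^{[s]} α = F` holds there off the axis and off
`{Δ = 0}`. NO support or decay condition anywhere (infinite weighted energies only void the law
`TeukolskySlabLawOn` for that pair; an inner-edge support condition would not be invariant under the
evolution on the penetrating chart). [cite: DafermosHolzegelRodnianskiTaylor2022, §1.1 (1.3)] -/
def IsTeukolskyPairOnSlab [Facts] (M a r₀ : ℝ) [(metric M a r₀).HasLeviCivita] (s : ℤ)
    (τ₀ τ₁ : ℝ) (α F : region a r₀ → ℂ) : Prop :=
  ∃ θ : ℝ, 0 < θ ∧
    (∃ T : region a r₀ → Fin 4 → Fin 4 → ℂ,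
      ContMDiffOn 𝓘(ℝ, E4) 𝓘(ℝ, Fin 4 → Fin 4 → ℂ) ∞ T
          {x | τ₀ - θ < (x : E4) 0 ∧ (x : E4) 0 < τ₁ + θ} ∧
        ∀ x : region a r₀, τ₀ - θ < (x : E4) 0 → (x : E4) 0 < τ₁ + θ → x.1 ∉ axis →
          delta M a (radius a x.1) ≠ 0 → T x = tensorise a s (rescale M a s α) x) ∧
    (∃ S : region a r₀ → Fin 4 → Fin 4 → ℂ,
      ContMDiffOn 𝓘(ℝ, E4) 𝓘(ℝ, Fin 4 → Fin 4 → ℂ) ∞ S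
          {x | τ₀ - θ < (x : E4) 0 ∧ (x : E4) 0 < τ₁ + θ} ∧
        ∀ x : region a r₀, τ₀ - θ < (x : E4) 0 → (x : E4) 0 < τ₁ + θ → x.1 ∉ axis →
          delta M a (radius a x.1) ≠ 0 → S x = tensorise a s (rescale M a s F) x) ∧
    ∀ x : region a r₀, τ₀ - θ < (x : E4) 0 → (x : E4) 0 < τ₁ + θ → x.1 ∉ axis →
      delta M a (radius a x.1) ≠ 0 → teukolskyOpOn M a r₀ s α x = F x

/-- **Weighted `k`-th order energy of `α̃ m_s ⊗ m_s` through `{t* = τ} ∩ {r > r₀} ∩ {y ∈ A}`**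
with weight `(1 + ‖y‖)^p`: `sliceSobolevEnergy` of `Kerr.tensorise a s (Kerr.rescale M a s α)` on the
chart `Kerr.region a r₀` (verbatim `Kerr.teukolskyEnergy` with `r₀` for `r₊`; the H21 stand-in for
DHR's `𝔼_{Σ_τ}[𝔡^k α̃^{[±2]}]`, Ann. PDE 5 (2019), §5.2, on horizon-penetrating leaves). The junk
values of `tensorise`/`rescale` on the axis and on `{Δ = 0}` are invisible: both sets meet every
leaf in a Lebesgue-null set, and `iteratedFDeriv` at a point off these closed sets only sees the
honest values. [folklore] -/
def teukolskyEnergyOn (M a r₀ : ℝ) (s : ℤ) (α : region a r₀ → ℂ) (τ : ℝ) (k : ℕ) (p : ℝ)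
    (A : Set E3) : ℝ≥0∞ :=
  sliceSobolevEnergy (region a r₀) (tensorise a s (rescale M a s α)) τ k p A

/-- On the exterior chart `r₀ = r₊` the energy is literally `Kerr.teukolskyEnergy`
(DHR, Ann. PDE 5 (2019), §5.2). [folklore] -/
theorem teukolskyEnergyOn_rPlus (M a : ℝ) (s : ℤ) (α : exterior M a → ℂ) (τ : ℝ) (k : ℕ) (p : ℝ)
    (A : Set E3) : teukolskyEnergyOn M a (rPlus M a) s α τ k p A = teukolskyEnergy M a s α τ k p A :=
  rfl

/-- The energy is monotone in the region of integration (DR arXiv:0811.0354, §4). [cite: arXiv08110354, §4] -/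
theorem teukolskyEnergyOn_mono (M a r₀ : ℝ) (s : ℤ) (α : region a r₀ → ℂ) (τ : ℝ) (k : ℕ) (p : ℝ)
    {A B : Set E3} (h : A ⊆ B) :
    teukolskyEnergyOn M a r₀ s α τ k p A ≤ teukolskyEnergyOn M a r₀ s α τ k p B :=
  sliceSobolevEnergy_mono _ _ τ k p h

/-- **The black-box spin-`s` law on slabs at one parameter set `(M, a, r₀, k, w, R, Λ)`** — the
format of Dafermos–Holzegel–Rodnianski–Taylor arXiv:2212.14093, (1.3) (there for `□_g` on exact Kerr,
consumed as the ONLY Kerr-specific input of a quasilinear stability proof), typed for the Teukolsky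
system `s = ±2`: for every slab `τ₀ ≤ τ₁` and every sourced pair on it, the first-order local
(`‖y‖ ≤ R`) energy of `α̃ m_s ⊗ m_s` through the top leaf plus its time integral over the slab is at
most `Λ ×` (the `(1+‖y‖)^w`-weighted `k`-th order energy through the bottom leaf + the
time-integrated weighted `k`-th order energy of the source). Uniform boundedness and integrated local
energy decay in one restartable inequality; `k > 1` allows the loss of derivatives at trapping, `R`
the locality, `w` the weights (all parameters, nothing asserted). A PREDICATE, not a named fact: which
`(k, w, Λ)` work at which `(M, a)` is the content of theorems/cruxes elsewhere (qualitatively on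
`|a| < M`: Shlapentokh-Rothman–Teixeira da Costa arXiv:2302.08916, Thm A).
[cite: DafermosHolzegelRodnianskiTaylor2022, §1.1 (1.3)] -/
def TeukolskySlabLawOn [Facts] (M a r₀ : ℝ) (k : ℕ) (w R Λ : ℝ) : Prop :=
  ∀ [(metric M a r₀).HasLeviCivita], ∀ s : ℤ, (s = 2 ∨ s = -2) →
    ∀ τ₀ τ₁ : ℝ, τ₀ ≤ τ₁ → ∀ α F : region a r₀ → ℂ, IsTeukolskyPairOnSlab M a r₀ s τ₀ τ₁ α F →
      teukolskyEnergyOn M a r₀ s α τ₁ 1 0 (Metric.closedBall 0 R) +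
          ∫⁻ τ in Ioo τ₀ τ₁, teukolskyEnergyOn M a r₀ s α τ 1 0 (Metric.closedBall 0 R) ≤
        ENNReal.ofReal Λ * (teukolskyEnergyOn M a r₀ s α τ₀ k w univ +
          ∫⁻ σ in Ioo τ₀ τ₁, teukolskyEnergyOn M a r₀ s F σ k w univ)

/-- The slab law is monotone in its constant (DHRT arXiv:2212.14093, (1.3)). [folklore] -/
theorem TeukolskySlabLawOn.mono [Facts] {M a r₀ : ℝ} {k : ℕ} {w R Λ Λ' : ℝ}
    (h : TeukolskySlabLawOn M a r₀ k w R Λ) (hΛ : Λ ≤ Λ') : TeukolskySlabLawOn M a r₀ k w R Λ' := by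
  intro _ s hs τ₀ τ₁ hτ α F hαF
  have hle : ENNReal.ofReal Λ ≤ ENNReal.ofReal Λ' := ENNReal.ofReal_le_ofReal hΛ
  exact (h s hs τ₀ τ₁ hτ α F hαF).trans (by gcongr)

/-- The Teukolsky operator on `{r > r₀}` annihilates the zero field (Teukolsky, ApJ 185 (1973),
(4.7)). [folklore] -/
theorem teukolskyOpOn_zero [Facts] (M a r₀ : ℝ) [(metric M a r₀).HasLeviCivita] (s : ℤ)
    (x : region a r₀) : teukolskyOpOn M a r₀ s (fun _ ↦ 0) x = 0 := by
  have h0 : Function.extend (Subtype.val : region a r₀ → E4) (fun _ ↦ (0 : ℂ)) (0 : E4 → ℂ)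
      = 0 := by
    funext y
    classical
    rw [Function.extend_def]
    split_ifs <;> rfl
  simp [teukolskyOpOn, cdalembertianOn, coordDeriv, h0,
    PseudoRiemannianMetric.dalembertian_const]

/-- The zero field is admissible on every chart `{r > r₀}` (the class is non-empty; DHR,
Ann. PDE 5 (2019), §4). [folklore] -/
theorem isAdmissibleTeukolskyFieldOn_zero [Facts] (M a r₀ : ℝ) [(metric M a r₀).HasLeviCivita]
    (s : ℤ) : IsAdmissibleTeukolskyFieldOn M a r₀ s (fun _ ↦ 0) := by
  refine ⟨⟨fun _ ↦ 0, contMDiff_const, fun x _ _ ↦ ?_, ∅, isCompact_empty, fun x _ _ ↦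
    ⟨rfl, mfderiv_const⟩⟩, fun x _ _ ↦ teukolskyOpOn_zero M a r₀ s x⟩
  rw [rescale_zero, tensorise_zero]

/-- The zero pair `(0, 0)` is an admissible sourced pair on every chart `{r > r₀}` (the pair class
is non-empty; DHRT arXiv:2212.14093, (1.3)). [folklore] -/
theorem isAdmissibleTeukolskyPairOn_zero [Facts] (M a r₀ : ℝ) [(metric M a r₀).HasLeviCivita]
    (s : ℤ) : IsAdmissibleTeukolskyPairOn M a r₀ s (fun _ ↦ 0) (fun _ ↦ 0) := by
  refine ⟨⟨fun _ ↦ 0, contMDiff_const, fun x _ _ ↦ ?_, ∅, isCompact_empty, fun x _ _ ↦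
    ⟨rfl, mfderiv_const⟩⟩, ⟨fun _ ↦ 0, contMDiff_const, fun x _ _ ↦ ?_⟩,
    fun x _ _ ↦ teukolskyOpOn_zero M a r₀ s x⟩
  · rw [rescale_zero, tensorise_zero]
  · rw [rescale_zero, tensorise_zero]

/-- The zero pair is a sourced pair on every slab of every chart (the slab class is non-empty, so
`TeukolskySlabLawOn … Λ` is consistent for every `Λ ≥ 0`; DHRT arXiv:2212.14093, (1.3)). [folklore] -/
theorem isTeukolskyPairOnSlab_zero [Facts] (M a r₀ : ℝ) [(metric M a r₀).HasLeviCivita] (s : ℤ)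
    (τ₀ τ₁ : ℝ) : IsTeukolskyPairOnSlab M a r₀ s τ₀ τ₁ (fun _ ↦ 0) (fun _ ↦ 0) := by
  refine ⟨1, one_pos, ⟨fun _ ↦ 0, contMDiffOn_const, fun x _ _ _ _ ↦ ?_⟩,
    ⟨fun _ ↦ 0, contMDiffOn_const, fun x _ _ _ _ ↦ ?_⟩,
    fun x _ _ _ _ ↦ teukolskyOpOn_zero M a r₀ s x⟩
  · rw [rescale_zero, tensorise_zero]
  · rw [rescale_zero, tensorise_zero]

/-- A homogeneous admissible field is an admissible pair with zero source (DHRT arXiv:2212.14093,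
(1.3) with `F = 0`). [folklore] -/
theorem IsAdmissibleTeukolskyFieldOn.pair_zero [Facts] {M a r₀ : ℝ} [(metric M a r₀).HasLeviCivita]
    {s : ℤ} {α : region a r₀ → ℂ} (h : IsAdmissibleTeukolskyFieldOn M a r₀ s α) :
    IsAdmissibleTeukolskyPairOn M a r₀ s α (fun _ ↦ 0) := by
  refine ⟨h.1, ⟨fun _ ↦ 0, contMDiff_const, fun x _ _ ↦ ?_⟩, fun x hx hΔ ↦ h.2 x hx hΔ⟩
  rw [rescale_zero, tensorise_zero]

/-- The energies of the zero field vanish on every chart (DHR, Ann. PDE 5 (2019), §5.2), so every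
energy law over the class is consistent. [folklore] -/
@[simp]
theorem teukolskyEnergyOn_zero (M a r₀ : ℝ) (s : ℤ) (τ : ℝ) (k : ℕ) (p : ℝ) (A : Set E3) :
    teukolskyEnergyOn M a r₀ s (fun _ ↦ 0) τ k p A = 0 := by
  simp [teukolskyEnergyOn]

/-! ### The exterior class of `Sweep2` is contained in the horizon-penetrating class at `r₀ = r₊` -/

/-- `zpow` of a `C^n` real function at a point where it does not vanish is `C^n` (cases on the sign
of the exponent: `pow`, resp. `inv ∘ pow`). [folklore] -/
private theorem contDiffAt_zpow_of_ne {F : Type*} [NormedAddCommGroup F] [NormedSpace ℝ F]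
    {f : F → ℝ} {p : F} {n : WithTop ℕ∞} (hf : ContDiffAt ℝ n f p) (h : f p ≠ 0) (m : ℤ) :
    ContDiffAt ℝ n (fun q ↦ f q ^ m) p := by
  cases m with
  | ofNat k =>
    simp only [Int.ofNat_eq_natCast, zpow_natCast]
    exact hf.pow k
  | negSucc k =>
    simp only [zpow_negSucc]
    exact (hf.pow (k + 1)).inv (pow_ne_zero _ h)

/-- On the exterior chart `{r > max r₊ 0}` the horizon function does not vanish:
`Δ(r) = (r − M)² − (M² − a²) > 0` for `r > r₊ = M + √(M² − a²)` — for ALL real `M, a` (for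
`a² > M²` the square root is the junk `0` and `Δ > 0` everywhere). Boyer–Lindquist 1967. [folklore] -/
theorem delta_pos_of_mem_exterior {M a : ℝ} {x : E4} (hx : x ∈ exterior M a) :
    0 < delta M a (radius a x) := by
  have hr : rPlus M a < radius a x := lt_radius_of_mem_region hx
  unfold rPlus at hr
  unfold delta
  have hs : 0 ≤ √(M ^ 2 - a ^ 2) := Real.sqrt_nonneg _
  have h1 : √(M ^ 2 - a ^ 2) < radius a x - M := by linarith
  have h2 : M ^ 2 - a ^ 2 < (radius a x - M) ^ 2 := by
    rcases le_or_gt (M ^ 2 - a ^ 2) 0 with hneg | hpos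
    · have h3 : 0 < (radius a x - M) ^ 2 := by
        have : 0 < radius a x - M := hs.trans_lt h1
        positivity
      linarith
    · have h3 : √(M ^ 2 - a ^ 2) ^ 2 = M ^ 2 - a ^ 2 := Real.sq_sqrt hpos.le
      nlinarith
  nlinarith

/-- The rescaling factor `Δ^s (r² + a²)^{−max(s,0)}` of `Kerr.rescale` is `C^∞` at every point of the
exterior chart (there `r > 0` and `Δ > 0`). DHR, Ann. PDE 5 (2019), §2.4. [folklore] -/
theorem contDiffAt_rescaleFactor {M a : ℝ} (s : ℤ) (x : exterior M a) :
    ContDiffAt ℝ ∞ (fun y : E4 ↦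
      delta M a (radius a y) ^ s * (radius a y ^ 2 + a ^ 2) ^ (-max s 0)) x.1 := by
  have hr0 : 0 < radius a x.1 := radius_pos_of_mem_region x.2
  have hr : ContDiffAt ℝ ∞ (fun y : E4 ↦ radius a y) x.1 :=
    contDiffAt_radius_comp (fa := fun _ : E4 ↦ a) (g := id) contDiffAt_const contDiffAt_id hr0
  have hΔ : ContDiffAt ℝ ∞ (fun y : E4 ↦ delta M a (radius a y)) x.1 := by
    unfold delta
    exact ((hr.pow 2).sub ((contDiffAt_const.mul hr))).add contDiffAt_const
  have hra : ContDiffAt ℝ ∞ (fun y : E4 ↦ radius a y ^ 2 + a ^ 2) x.1 :=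
    (hr.pow 2).add contDiffAt_const
  have hra0 : radius a x.1 ^ 2 + a ^ 2 ≠ 0 := by positivity
  exact (contDiffAt_zpow_of_ne hΔ (delta_pos_of_mem_exterior x.2).ne' s).mul
    (contDiffAt_zpow_of_ne hra hra0 _)

/-- **The exterior admissible class is contained in the horizon-penetrating class at `r₀ = r₊`.**
An admissible spin-`s` Teukolsky field on the open exterior in the sense of `Sweep2`
(`Kerr.IsAdmissibleTeukolskyField`: smooth extension `T` of `α m_s ⊗ m_s` across the axis, compact
data, equation off the axis) is admissible on the chart `Kerr.region a r₊ = Kerr.exterior M a` in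
the sense of `IsAdmissibleTeukolskyFieldOn`: the rescaled field `α̃ m_s ⊗ m_s` extends by
`f • T`, `f = Δ^s (r² + a²)^{−max(s,0)}` smooth on the exterior (`contDiffAt_rescaleFactor`), with
the same compact data set (`f • T` and `d(f • T) = f dT + df ⊗ T` vanish where `T`, `dT` do), and the
equation is the same (`teukolskyOpOn_rPlus`). So every law stated over the new class restricts to the
old one. DHR, Ann. PDE 5 (2019), §2.4. [folklore] -/
theorem IsAdmissibleTeukolskyField.fieldOn [Facts] {M a : ℝ} [(metric M a (rPlus M a)).HasLeviCivita]
    {s : ℤ} {α : exterior M a → ℂ} (h : IsAdmissibleTeukolskyField M a s α) :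
    IsAdmissibleTeukolskyFieldOn M a (rPlus M a) s α := by
  classical
  obtain ⟨⟨T, hT, hTeq, K, hK, hdata⟩, heq⟩ := h
  -- the rescaling factor, on `E4` and on the chart
  set Φ : E4 → ℝ := fun y ↦ delta M a (radius a y) ^ s * (radius a y ^ 2 + a ^ 2) ^ (-max s 0)
    with hΦ
  set f : exterior M a → ℝ := fun x ↦ Φ x.1 with hf
  have hfs : ContMDiff 𝓘(ℝ, E4) 𝓘(ℝ, ℝ) ∞ f := fun x ↦
    (OpensChart.contMDiffAt_iff x f Φ (fun _ ↦ rfl)).2 (contDiffAt_rescaleFactor s x)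
  refine ⟨⟨fun x ↦ f x • T x, hfs.smul hT, fun x hx _ ↦ ?_, K, hK, fun x hx0 hxK ↦ ?_⟩,
    fun x hx _ ↦ heq x hx⟩
  · -- agreement with the rescaled tensorisation off the axis
    show f x • T x = tensorise a s (rescale M a s α) x
    rw [show T x = tensorise a s α x from hTeq x hx]
    funext μ ν
    simp only [Pi.smul_apply, tensorise, rescale, Complex.real_smul, hf, hΦ]
    ring
  · -- compact data: `f • T` and its differential vanish where `T` and `dT` vanish
    obtain ⟨hT0, hdT0⟩ := hdata x hx0 hxK
    refine ⟨by simp [hT0], ?_⟩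
    -- representatives on `E4`
    set Ψ : E4 → Fin 4 → Fin 4 → ℂ := fun y ↦ if hy : y ∈ exterior M a then T ⟨y, hy⟩ else 0
      with hΨ
    have hrep : ∀ y : exterior M a, T y = Ψ y.1 := fun y ↦ by
      simp only [hΨ, SetLike.coe_mem, ↓reduceDIte]
    have hΨd : DifferentiableAt ℝ Ψ x.1 :=
      (OpensChart.mdifferentiableAt_iff x T Ψ hrep).1 (hT.mdifferentiableAt (by simp) )
    have hΨ0 : Ψ x.1 = 0 := (hrep x).symm.trans hT0
    have hdΨ0 : fderiv ℝ Ψ x.1 = 0 := by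
      rw [← OpensChart.mfderiv_eq x T Ψ hrep hΨd]
      exact hdT0
    have hΦd : DifferentiableAt ℝ Φ x.1 := (contDiffAt_rescaleFactor s x).differentiableAt (by simp)
    have hrep' : ∀ y : exterior M a, f y • T y = (fun z ↦ Φ z • Ψ z) y.1 := fun y ↦ by
      simp only [hf, hrep y]
    have h0 : fderiv ℝ (fun z ↦ Φ z • Ψ z) x.1 = 0 := by
      rw [fderiv_fun_smul hΦd hΨd, hΨ0, hdΨ0]
      simp
    rw [OpensChart.mfderiv_eq x (fun y ↦ f y • T y) (fun z ↦ Φ z • Ψ z) hrep' (hΦd.smul hΨd), h0]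
    rfl

end Literature.Geometry.Lorentzian.Kerr

end
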